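import Mathlib
import Literature.Probability.LatticeModels.LoopO1
import Literature.Combinatorics.SimpleGraph.CycleSpaceSeparators
import Summits.CriticalPhenomena.Ising3DConformalLimit.Theorems.FKParityRobustnessDepletionBoundHTE
import HarnessLib

/-!
# Crux IndependentStrandsJoin (stmt-CriticalPhenomena-14625), line Sketch — stub symmetry

Stub 4 of the line skeleton (`stub_symmetry`, the PAIRING SYMMETRY on a general finite graph).
For a finite simple graph `G`, an edge weight `t ≥ 0`, a marked quadruple `a : Fin 4 → V`,
`A = {a₀, a₁, a₂, a₃}`, `𝒯(B) = tJoins G univ B` (the `T`-joins of `G` with source set `B`) and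
`Z^B = loopO1PartitionFunction G t B = Σ_{F ∈ 𝒯(B)} t^{|F|}` (`loopO1PartitionFunction_eq_hteSum`
and `sum_tJoins_pow_eq_hteSum` of `Theorems/FKParityRobustnessDepletionBoundHTE.lean`),
suppose `G` has automorphisms `φ`, `ψ` fixing `a₀` and realising the transpositions `(a₁ a₂)`
(`φ`, which also fixes `a₃`) and `(a₁ a₃)` (`ψ`, which also fixes `a₂`) of the quadruple.  Then

* `3 · sepSum ≤ Z^A`, where `sepSum = Σ_{D ∈ 𝒯(A), a₀ ↝̸_D a₂, a₀ ↝̸_D a₃} t^{|D|}`;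
* `Z^{02} Z^{13} = Z^{01} Z^{23}` and `Z^{03} Z^{12} = Z^{01} Z^{23}` (`Z^{ij} = Z^{{aᵢ, aⱼ}}`).

Proof.  TRANSPORT: an isomorphism `φ : G ≃g G'` acts on edge sets by
`D ↦ φD = D.image (Sym2.map φ)`; this preserves `|D|`, maps `𝒯(B)` into `𝒯(φB)` (the
`φD`-degree of `φ v` is the `D`-degree of `v`, `image_sym2Map_mem_tJoins`), is undone by the
action of `φ⁻¹`, and
`φ u ↝_{φD} φ v ↔ u ↝_D v` (`φ` is an isomorphism `fromEdgeSet D ≃g fromEdgeSet φD`,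
`reachable_image_sym2Map_iff`).  Hence `Z^{φB} = Z^B` (`loopO1PartitionFunction_transport`; the
pair identities follow from `φ{a₀,a₁} = {a₀,a₂}`, `φ{a₂,a₃} = {a₁,a₃}`, `ψ{a₀,a₁} = {a₀,a₃}`,
`ψ{a₂,a₃} = {a₁,a₂}`), and filtered sums over `𝒯(A)` are transported along `φ`, `ψ`, which fix
`A` (`sum_filter_tJoins_transport`): the three separated pairing classes of `𝒯(A)`,
`Sep₀₁ = {a₀ ↝̸ a₂, a₀ ↝̸ a₃}`, `Sep₀₂ = {a₀ ↝̸ a₁, a₀ ↝̸ a₃}`, `Sep₀₃ = {a₀ ↝̸ a₁, a₀ ↝̸ a₂}`,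
have equal weight (`φ : Sep₀₁ → Sep₀₂`, `ψ : Sep₀₁ → Sep₀₃`).  DISJOINTNESS
(`not_separated_of_mem_tJoins`): a `D ∈ 𝒯(A)` lying in two of the classes would have
`a₀ ↝̸_D aᵢ` for every `i ≠ 0`; but `a₀ ∈ A` has odd `D`-degree and the members of
`D ⊆ E(G)` are genuine edges, so by the handshake lemma in the `a₀`-component
(`exists_reachable_odd_of_odd`) some `w ≠ a₀` of odd `D`-degree — a source, i.e. some `aᵢ` with
`i ≠ 0` — is `D`-reachable from `a₀`.  Therefore (`three_mul_sum_filter_le`, using `t ≥ 0`)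
`3 · sepSum = Σ_{Sep₀₁} + Σ_{Sep₀₂} + Σ_{Sep₀₃} = Σ_{Sep₀₁ ∪ Sep₀₂ ∪ Sep₀₃} ≤ Σ_{𝒯(A)} t^{|D|}`,
which is `Z^A`.
The injectivity of `a` is not used.

Sources: folklore (automorphism invariance of the high-temperature / loop O(1) expansion and the
handshake lemma); U. T. Hansen, J. Jiang, F. R. Klausen, arXiv:2506.10765, §2, for `𝒯(B)` and `Z^B`
(tree file `Literature/Probability/LatticeModels/LoopO1.lean`).
-/

noncomputable section

open Finset SimpleGraph
open Literature.Probability.LatticeModels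
open scoped Classical BigOperators

namespace Summit.CriticalPhenomena.Ising3DConformalLimit.Theorems

namespace StubSymmetry

open Literature.Combinatorics.SimpleGraph.CycleSpace

variable {V W : Type*}

/-! ### Transport of edge sets along a bijection of the vertices -/

/-- For an injective `f`, the vertex `f v` lies on the transported pair `Sym2.map f e` iff `v` lies
on `e`. -/
theorem apply_mem_sym2Map_iff {f : V → W} (hf : Function.Injective f) (v : V) (e : Sym2 V) :
    f v ∈ Sym2.map f e ↔ v ∈ e := by
  rw [Sym2.mem_map]
  constructor
  · rintro ⟨u, hu, huv⟩
    rwa [← hf huv]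
  · exact fun hv => ⟨v, hv, rfl⟩

variable [DecidableEq V] [DecidableEq W]

/-- A map permuting the values of a family `a` fixes the set of its values. -/
theorem image_image_univ_eq {n : ℕ} (a : Fin n → V) (f : V → V) (h : ∀ i, ∃ j, f (a i) = a j)
    (h' : ∀ j, ∃ i, f (a i) = a j) : (Finset.univ.image a).image f = Finset.univ.image a := by
  ext x
  constructor
  · intro hx
    obtain ⟨y, hy, rfl⟩ := Finset.mem_image.1 hx
    obtain ⟨i, -, rfl⟩ := Finset.mem_image.1 hy
    obtain ⟨j, hj⟩ := h i
    rw [hj]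
    exact Finset.mem_image_of_mem a (Finset.mem_univ j)
  · intro hx
    obtain ⟨j, -, rfl⟩ := Finset.mem_image.1 hx
    obtain ⟨i, hi⟩ := h' j
    rw [← hi]
    exact Finset.mem_image_of_mem f (Finset.mem_image_of_mem a (Finset.mem_univ i))

/-- A left inverse undoes `Finset.image`. -/
theorem image_image_of_leftInverse {f : V → W} {g : W → V} (h : Function.LeftInverse g f)
    (B : Finset V) : (B.image f).image g = B := by
  rw [Finset.image_image, h.comp_eq_id, Finset.image_id]

/-- A left inverse undoes the transport of edge sets. -/
theorem image_sym2Map_image_of_leftInverse {f : V → W} {g : W → V} (h : Function.LeftInverse g f)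
    (D : Finset (Sym2 V)) : (D.image (Sym2.map f)).image (Sym2.map g) = D := by
  rw [Finset.image_image, ← Sym2.map_comp, h.comp_eq_id, Sym2.map_id, Finset.image_id]

/-- Degrees are transported: the `fD`-degree of `f v` is the `D`-degree of `v` (`f` injective). -/
theorem card_filter_image_sym2Map {f : V → W} (hf : Function.Injective f) (D : Finset (Sym2 V))
    (v : V) :
    #((D.image (Sym2.map f)).filter (fun e => f v ∈ e)) = #(D.filter (fun e => v ∈ e)) := by
  rw [Finset.filter_image, Finset.card_image_of_injective _ (Sym2.map.injective hf)]
  congr 1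
  exact Finset.filter_congr fun e _ => apply_mem_sym2Map_iff hf v e

omit [DecidableEq V] in
/-- Reachability is transported: for a graph isomorphism `φ`, `φ u ↝_{φD} φ v ↔ u ↝_D v`, because
`φ` is an isomorphism `fromEdgeSet D ≃g fromEdgeSet φD`. -/
theorem reachable_image_sym2Map_iff {G : SimpleGraph V} {G' : SimpleGraph W} (φ : G ≃g G')
    (D : Finset (Sym2 V)) (u v : V) :
    (fromEdgeSet (↑(D.image (Sym2.map φ)) : Set (Sym2 W))).Reachable (φ u) (φ v) ↔
      (fromEdgeSet (↑D : Set (Sym2 V))).Reachable u v := by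
  let θ : fromEdgeSet (↑D : Set (Sym2 V)) ≃g fromEdgeSet (↑(D.image (Sym2.map φ)) : Set (Sym2 W)) :=
    ⟨φ.toEquiv, by
      intro x y
      show (fromEdgeSet (↑(D.image (Sym2.map φ)) : Set (Sym2 W))).Adj (φ x) (φ y) ↔ _
      rw [fromEdgeSet_adj, fromEdgeSet_adj, Finset.mem_coe, Finset.mem_coe, ← Sym2.map_mk φ x y,
        (Sym2.map.injective φ.injective).mem_finset_image, φ.injective.ne_iff]⟩
  exact Iso.reachable_iff (φ := θ)

variable [Fintype V] [Fintype W] {G : SimpleGraph V} [DecidableRel G.Adj] {G' : SimpleGraph W}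
  [DecidableRel G'.Adj]

/-- `T`-joins are transported: if `D ∈ 𝒯_G(B)` then `φD ∈ 𝒯_{G'}(φB)` for an isomorphism
`φ : G ≃g G'` (edges go to edges, and the `φD`-degree of `φ v` is the `D`-degree of `v`). -/
theorem image_sym2Map_mem_tJoins (φ : G ≃g G') {B : Finset V} {B' : Finset W}
    (hB : B.image φ = B') {D : Finset (Sym2 V)} (hD : D ∈ tJoins G Set.univ B) :
    D.image (Sym2.map φ) ∈ tJoins G' Set.univ B' := by
  subst hB
  rw [mem_tJoins] at hD ⊢
  obtain ⟨hDE, -, hdeg⟩ := hD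
  refine ⟨fun e he => ?_, Set.subset_univ _, fun w => ?_⟩
  · obtain ⟨e₀, he₀, rfl⟩ := Finset.mem_image.1 he
    exact mem_edgeFinset.2 ((Iso.map_mem_edgeSet_iff φ).2 (mem_edgeFinset.1 (hDE he₀)))
  · obtain ⟨v, rfl⟩ := φ.surjective w
    rw [card_filter_image_sym2Map φ.injective D v, hdeg v, φ.injective.mem_finset_image]

/-- Filtered `T`-join sums are transported along an isomorphism `φ : G ≃g G'`:
`Σ_{D ∈ 𝒯_G(B), P D} t^{|D|} = Σ_{D' ∈ 𝒯_{G'}(φB), P' D'} t^{|D'|}` whenever `P D ↔ P' (φD)` on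
`𝒯_G(B)` (`D ↦ φD` is a weight-preserving bijection, inverted by `D' ↦ φ⁻¹D'`). -/
theorem sum_filter_tJoins_transport (φ : G ≃g G') (B : Finset V) (B' : Finset W)
    (hB : B.image φ = B') (t : ℝ) (P : Finset (Sym2 V) → Prop) (P' : Finset (Sym2 W) → Prop)
    [DecidablePred P] [DecidablePred P']
    (hP : ∀ D ∈ tJoins G Set.univ B, (P D ↔ P' (D.image (Sym2.map φ)))) :
    ∑ D ∈ (tJoins G Set.univ B).filter P, t ^ #D =
      ∑ D ∈ (tJoins G' Set.univ B').filter P', t ^ #D := by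
  have hB' : B'.image φ.symm = B := by
    rw [← hB, image_image_of_leftInverse φ.symm_apply_apply]
  refine Finset.sum_nbij' (fun D => D.image (Sym2.map φ)) (fun D => D.image (Sym2.map φ.symm))
    ?_ ?_ ?_ ?_ ?_
  · intro D hD
    simp only [Finset.mem_filter] at hD ⊢
    exact ⟨image_sym2Map_mem_tJoins φ hB hD.1, (hP D hD.1).1 hD.2⟩
  · intro D hD
    simp only [Finset.mem_filter] at hD ⊢
    have h1 : D.image (Sym2.map φ.symm) ∈ tJoins G Set.univ B :=
      image_sym2Map_mem_tJoins φ.symm hB' hD.1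
    refine ⟨h1, (hP _ h1).2 ?_⟩
    rw [image_sym2Map_image_of_leftInverse φ.apply_symm_apply]
    exact hD.2
  · intro D _
    exact image_sym2Map_image_of_leftInverse φ.symm_apply_apply D
  · intro D _
    exact image_sym2Map_image_of_leftInverse φ.apply_symm_apply D
  · intro D _
    rw [Finset.card_image_of_injective _ (Sym2.map.injective φ.injective)]

/-- Partition functions are transported: `Z_{G'}^{φB} = Z_G^B` for an isomorphism `φ : G ≃g G'`. -/
theorem loopO1PartitionFunction_transport (φ : G ≃g G') (t : ℝ) (B : Finset V) (B' : Finset W)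
    (hB : B.image φ = B') : loopO1PartitionFunction G' t B' = loopO1PartitionFunction G t B := by
  rw [DepletionBound.loopO1PartitionFunction_eq_hteSum,
    DepletionBound.loopO1PartitionFunction_eq_hteSum, ← DepletionBound.sum_tJoins_pow_eq_hteSum,
    ← DepletionBound.sum_tJoins_pow_eq_hteSum]
  have h := sum_filter_tJoins_transport φ B B' hB t (fun _ => True) (fun _ => True)
    (fun _ _ => Iff.rfl)
  rw [Finset.filter_true, Finset.filter_true] at h
  exact h.symm

/-! ### The handshake lemma in the `a₀`-component, and the counting step -/

omit [Fintype W] [DecidableEq W] in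
/-- In a `T`-join `D` of `G` with source set `{a₀, a₁, a₂, a₃}`, the source `a₀` is `D`-joined to
another source: `a₀` has odd `D`-degree, so (handshake lemma in the `a₀`-component of the loop-free
edge set `D ⊆ E(G)`) some `w ≠ a₀` of odd `D`-degree, necessarily some `aᵢ` with `i ≠ 0`, is
`D`-reachable from `a₀`. -/
theorem not_separated_of_mem_tJoins (a : Fin 4 → V) {D : Finset (Sym2 V)}
    (hD : D ∈ tJoins G Set.univ (Finset.univ.image a))
    (h1 : ¬ (fromEdgeSet (↑D : Set (Sym2 V))).Reachable (a 0) (a 1))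
    (h2 : ¬ (fromEdgeSet (↑D : Set (Sym2 V))).Reachable (a 0) (a 2))
    (h3 : ¬ (fromEdgeSet (↑D : Set (Sym2 V))).Reachable (a 0) (a 3)) : False := by
  rw [mem_tJoins] at hD
  obtain ⟨hDE, -, hdeg⟩ := hD
  have hdiag : ∀ e ∈ D, ¬ e.IsDiag := fun e he =>
    G.not_isDiag_of_mem_edgeSet (mem_edgeFinset.1 (hDE he))
  obtain ⟨w, hw0, hreach, hwodd⟩ := exists_reachable_odd_of_odd D hdiag
    ((hdeg (a 0)).2 (Finset.mem_image_of_mem a (Finset.mem_univ _)))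
  obtain ⟨i, -, rfl⟩ := Finset.mem_image.1 ((hdeg _).1 hwodd)
  fin_cases i
  · exact hw0 rfl
  · exact h1 hreach
  · exact h2 hreach
  · exact h3 hreach

/-- The counting step: if three classes `T.filter Pᵢ` of a finite family with nonnegative weights
are pairwise disjoint and have equal weight, then three times the weight of one of them is at most
the total weight. -/
theorem three_mul_sum_filter_le {ι : Type*} [DecidableEq ι] (T : Finset ι) (P₁ P₂ P₃ : ι → Prop)
    [DecidablePred P₁] [DecidablePred P₂] [DecidablePred P₃] (w : ι → ℝ) (hw : ∀ D ∈ T, 0 ≤ w D)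
    (h₁₂ : ∑ D ∈ T.filter P₁, w D = ∑ D ∈ T.filter P₂, w D)
    (h₁₃ : ∑ D ∈ T.filter P₁, w D = ∑ D ∈ T.filter P₃, w D)
    (hx₁₂ : ∀ D ∈ T, P₁ D → P₂ D → False) (hx₁₃ : ∀ D ∈ T, P₁ D → P₃ D → False)
    (hx₂₃ : ∀ D ∈ T, P₂ D → P₃ D → False) :
    3 * ∑ D ∈ T.filter P₁, w D ≤ ∑ D ∈ T, w D := by
  have hd₁₂ : Disjoint (T.filter P₁) (T.filter P₂) := Finset.disjoint_filter.2 hx₁₂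
  have hd₁₃ : Disjoint (T.filter P₁) (T.filter P₃) := Finset.disjoint_filter.2 hx₁₃
  have hd₂₃ : Disjoint (T.filter P₂) (T.filter P₃) := Finset.disjoint_filter.2 hx₂₃
  have hsub : T.filter P₁ ∪ T.filter P₂ ∪ T.filter P₃ ⊆ T :=
    Finset.union_subset (Finset.union_subset (Finset.filter_subset _ _) (Finset.filter_subset _ _))
      (Finset.filter_subset _ _)
  calc 3 * ∑ D ∈ T.filter P₁, w D
      = ∑ D ∈ T.filter P₁, w D + ∑ D ∈ T.filter P₂, w D + ∑ D ∈ T.filter P₃, w D := by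
        rw [← h₁₂, ← h₁₃]; ring
    _ = ∑ D ∈ T.filter P₁ ∪ T.filter P₂ ∪ T.filter P₃, w D := by
        rw [Finset.sum_union (Finset.disjoint_union_left.2 ⟨hd₁₃, hd₂₃⟩), Finset.sum_union hd₁₂]
    _ ≤ ∑ D ∈ T, w D := Finset.sum_le_sum_of_subset_of_nonneg hsub fun D hD _ => hw D hD

end StubSymmetry

/-- **Stub 4 (pairing symmetry, general graph).**  If `G` has automorphisms fixing `a₀` that
realise the transpositions `(a₁ a₂)` and `(a₁ a₃)` on the marked quadruple, then the three
separated pairing classes of `𝒯(a₀a₁a₂a₃)` have equal weight (so `3 · sepSum ≤ Z^{0123}`, the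
classes being disjoint by the handshake lemma) and the pair partition functions are exchanged:
`Z^{02}Z^{13} = Z^{01}Z^{23} = Z^{03}Z^{12}` (transport of `tJoins` along a graph isomorphism; the
injectivity of `a` is not needed). -/
theorem stub_symmetry :
    ∀ (V : Type) [Fintype V] [DecidableEq V] (G : SimpleGraph V) [DecidableRel G.Adj] (t : ℝ),
      0 ≤ t → ∀ a : Fin 4 → V, Function.Injective a →
      (∃ φ : G ≃g G, φ (a 0) = a 0 ∧ φ (a 1) = a 2 ∧ φ (a 2) = a 1 ∧ φ (a 3) = a 3) →
      (∃ ψ : G ≃g G, ψ (a 0) = a 0 ∧ ψ (a 1) = a 3 ∧ ψ (a 3) = a 1 ∧ ψ (a 2) = a 2) →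
      3 * (∑ D ∈ (tJoins G Set.univ (Finset.univ.image a)).filter (fun D : Finset (Sym2 V) =>
            ¬ (SimpleGraph.fromEdgeSet (↑D : Set (Sym2 V))).Reachable (a 0) (a 2) ∧
            ¬ (SimpleGraph.fromEdgeSet (↑D : Set (Sym2 V))).Reachable (a 0) (a 3)),
            t ^ D.card)
          ≤ loopO1PartitionFunction G t (Finset.univ.image a) ∧
      loopO1PartitionFunction G t {a 0, a 2} * loopO1PartitionFunction G t {a 1, a 3} =
        loopO1PartitionFunction G t {a 0, a 1} * loopO1PartitionFunction G t {a 2, a 3} ∧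
      loopO1PartitionFunction G t {a 0, a 3} * loopO1PartitionFunction G t {a 1, a 2} =
        loopO1PartitionFunction G t {a 0, a 1} * loopO1PartitionFunction G t {a 2, a 3} := by
  intro V _ _ G _ t ht a _ hφ hψ
  obtain ⟨φ, hφ0, hφ1, hφ2, hφ3⟩ := hφ
  obtain ⟨ψ, hψ0, hψ1, hψ3, hψ2⟩ := hψ
  -- both automorphisms fix the source set `A = {a₀, a₁, a₂, a₃}`
  have hAφ : (Finset.univ.image a).image φ = Finset.univ.image a :=
    StubSymmetry.image_image_univ_eq a φ
      (fun i => by fin_cases i; exacts [⟨0, hφ0⟩, ⟨2, hφ1⟩, ⟨1, hφ2⟩, ⟨3, hφ3⟩])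
      (fun j => by fin_cases j; exacts [⟨0, hφ0⟩, ⟨2, hφ2⟩, ⟨1, hφ1⟩, ⟨3, hφ3⟩])
  have hAψ : (Finset.univ.image a).image ψ = Finset.univ.image a :=
    StubSymmetry.image_image_univ_eq a ψ
      (fun i => by fin_cases i; exacts [⟨0, hψ0⟩, ⟨3, hψ1⟩, ⟨2, hψ2⟩, ⟨1, hψ3⟩])
      (fun j => by fin_cases j; exacts [⟨0, hψ0⟩, ⟨3, hψ3⟩, ⟨2, hψ2⟩, ⟨1, hψ1⟩])
  refine ⟨?_, ?_, ?_⟩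
  · -- `3 · sepSum ≤ Z^A`: the classes `Sep₀₁, Sep₀₂, Sep₀₃` are disjoint and of equal weight
    rw [DepletionBound.loopO1PartitionFunction_eq_hteSum, ← DepletionBound.sum_tJoins_pow_eq_hteSum]
    refine StubSymmetry.three_mul_sum_filter_le _ _
      (fun D : Finset (Sym2 V) =>
        ¬ (SimpleGraph.fromEdgeSet (↑D : Set (Sym2 V))).Reachable (a 0) (a 1) ∧
        ¬ (SimpleGraph.fromEdgeSet (↑D : Set (Sym2 V))).Reachable (a 0) (a 3))
      (fun D : Finset (Sym2 V) =>
        ¬ (SimpleGraph.fromEdgeSet (↑D : Set (Sym2 V))).Reachable (a 0) (a 1) ∧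
        ¬ (SimpleGraph.fromEdgeSet (↑D : Set (Sym2 V))).Reachable (a 0) (a 2))
      (fun D => t ^ D.card) (fun D _ => pow_nonneg ht _) ?_ ?_ ?_ ?_ ?_
    · -- `φ : Sep₀₁ → Sep₀₂`
      exact StubSymmetry.sum_filter_tJoins_transport φ _ _ hAφ t _ _ fun D _ => by
        rw [← StubSymmetry.reachable_image_sym2Map_iff φ D (a 0) (a 2),
          ← StubSymmetry.reachable_image_sym2Map_iff φ D (a 0) (a 3), hφ0, hφ2, hφ3]
    · -- `ψ : Sep₀₁ → Sep₀₃`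
      exact StubSymmetry.sum_filter_tJoins_transport ψ _ _ hAψ t _ _ fun D _ => by
        rw [← StubSymmetry.reachable_image_sym2Map_iff ψ D (a 0) (a 2),
          ← StubSymmetry.reachable_image_sym2Map_iff ψ D (a 0) (a 3), hψ0, hψ2, hψ3]
        exact and_comm
    · exact fun D hD h₁ h₂ => StubSymmetry.not_separated_of_mem_tJoins a hD h₂.1 h₁.1 h₁.2
    · exact fun D hD h₁ h₃ => StubSymmetry.not_separated_of_mem_tJoins a hD h₃.1 h₁.1 h₁.2
    · exact fun D hD h₂ h₃ => StubSymmetry.not_separated_of_mem_tJoins a hD h₂.1 h₃.2 h₂.2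
  · -- `Z^{02} = Z^{φ{01}} = Z^{01}` and `Z^{13} = Z^{φ{23}} = Z^{23}`
    rw [← StubSymmetry.loopO1PartitionFunction_transport φ t {a 0, a 1} {a 0, a 2}
        (by rw [Finset.image_insert, Finset.image_singleton, hφ0, hφ1]),
      ← StubSymmetry.loopO1PartitionFunction_transport φ t {a 2, a 3} {a 1, a 3}
        (by rw [Finset.image_insert, Finset.image_singleton, hφ2, hφ3])]
  · -- `Z^{03} = Z^{ψ{01}} = Z^{01}` and `Z^{12} = Z^{ψ{23}} = Z^{23}`
    rw [← StubSymmetry.loopO1PartitionFunction_transport ψ t {a 0, a 1} {a 0, a 3}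
        (by rw [Finset.image_insert, Finset.image_singleton, hψ0, hψ1]),
      ← StubSymmetry.loopO1PartitionFunction_transport ψ t {a 2, a 3} {a 1, a 2}
        (by rw [Finset.image_insert, Finset.image_singleton, hψ2, hψ3, Finset.pair_comm])]

end Summit.CriticalPhenomena.Ising3DConformalLimit.Theorems
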